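import Literature.Geometry.Lorentzian.KerrCylinderVacuum
import Literature.Geometry.Lorentzian.InitialDataDilation
import Mathlib.Analysis.SpecialFunctions.SmoothTransition
import HarnessLib

/-!
# A global exact Kerr-cylinder datum on `E3`: the conclusion predicate `IsKerrCylinderOn` of
# Li–Mei 2020, Prop. 4.1 is inhabited, by a datum which is vacuum on `{1 < ‖y‖}`

Support file (all results proved; no named facts) for the named fact `LiMei.interiorKerrGluing`
(`InteriorKerrGluing.lean`; J. Li, H. Mei, *A construction of collapsing spacetimes in vacuum*,
Comm. Math. Phys. 378 (2020) = arXiv:2005.01249, Prop. 4.1). The conclusion of the fact asks for a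
datum on ALL of `E3` which on an outer annulus is "the Kerr initial data induced on the slice
`{r = r₀}` inside the black hole with parameters `(m, a⃗)`" (p. 22), transported as
`LiMei.IsKerrCylinderOn m a r₀ τ₀ R s D'`. This file constructs, for all admissible parameters
`|a| < m`, `r₋(m, a) < r₀ < r₊(m, a)`, any time shift `τ₀` and axis rotation `R`, a smooth datum
`LiMei.kerrCylinderDatum` on `E3` which IS that Kerr-cylinder datum on `{1 ≤ ‖y‖}`:

* on the punctured space the fields are `H₀ = ψ^* g_{m,a}` (`cylH₀`) and `K₀ = K_ν(ψ)` (`cylK₀`) for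
  the cylinder map `ψ = kerrCylMap r₀ a τ₀ R` (`KerrInteriorCylinder.lean`) and its future unit normal;
  they are smooth there (`contDiffOn_cylH₀`, `contDiffOn_cylK₀`: the derivative of the smooth
  cylinder map, and O'Neill's "the shape tensor is a smooth tensor field",
  `contMDiffAt_secondFundamentalForm_apply`, with the smooth lift of `ν`,
  `contMDiff_kerrCylUnitNormal_lift`);
* they are cut off near the origin with `χ(y) = smoothTransition (4‖y‖² − 1)` (`= 0` on
  `‖y‖ ≤ 1/2`, `= 1` on `1/√2 ≤ ‖y‖`): `h = χ H₀ + (1 − χ) δ` (positive definite as a convex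
  combination), `k = χ K₀` — smooth on all of `E3` (`contDiffAt_cutoff_smul`);
* `LiMei.isKerrCylinderOn_kerrCylinderDatum` — **the datum is exactly the Kerr cylinder on
  `{1 < ‖y‖}`** in the sense of the fact (frame, future unit normal, `h = ψ^* g`, `k = K_ν(ψ)`), and
  `LiMei.isVacuumOn_kerrCylinderDatum` — **it solves the vacuum constraints there**
  (`isVacuumOn_of_isKerrCylinderOn`, `KerrCylinderVacuum.lean`).

So the predicate in which the fact's conclusion is phrased is satisfiable for every admissible
parameter (anti-vacuity), and the tree has the explicit Kerrian end that a capping/extension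
construction starts from.

## References

* J. Li, H. Mei, *A construction of collapsing spacetimes in vacuum*, Comm. Math. Phys. 378
  (2020), arXiv:2005.01249, §4, p. 22 and Prop. 4.1 (key `LiMei2020`).
* B. O'Neill, *Semi-Riemannian geometry* (1983), Ch. 4, Lemma 4 and Lemma 4.4 (key `ONeill1983`).
* Y. Choquet-Bruhat, *General Relativity and the Einstein Equations* (2009), Ch. VI, Thm. 3.3
  (key `ChoquetBruhat2009`).
-/

noncomputable section

open Bundle Set TopologicalSpace Manifold Module Filter Function
open scoped Manifold ContDiff Topology RealInnerProductSpace

namespace Literature.Geometry.Lorentzian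

namespace LiMei

/-! ### The cut-off -/

/-- The radial cut-off `χ(y) = smoothTransition (4‖y‖² − 1)`: smooth, `0 ≤ χ ≤ 1`, `χ = 0` on
`{‖y‖ ≤ 1/2}` and `χ = 1` on `{1 ≤ ‖y‖}` (indeed on `{1/√2 ≤ ‖y‖}`). [folklore] -/
def cylCutoff (y : E3) : ℝ := Real.smoothTransition (4 * ‖y‖ ^ 2 - 1)

/-- The cut-off is smooth. [folklore] -/
theorem contDiff_cylCutoff : ContDiff ℝ ∞ cylCutoff :=
  Real.smoothTransition.contDiff.comp ((contDiff_const.mul (contDiff_norm_sq ℝ)).sub contDiff_const)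

/-- `0 ≤ χ`. [folklore] -/
theorem cylCutoff_nonneg (y : E3) : 0 ≤ cylCutoff y := Real.smoothTransition.nonneg _

/-- `χ ≤ 1`. [folklore] -/
theorem cylCutoff_le_one (y : E3) : cylCutoff y ≤ 1 := Real.smoothTransition.le_one _

/-- `χ = 0` on the ball `{‖y‖ ≤ 1/2}`. [folklore] -/
theorem cylCutoff_of_norm_le {y : E3} (hy : ‖y‖ ≤ 2⁻¹) : cylCutoff y = 0 :=
  Real.smoothTransition.zero_of_nonpos (by nlinarith [norm_nonneg y])

/-- `χ = 1` on `{1 ≤ ‖y‖}`. [folklore] -/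
theorem cylCutoff_of_le_norm {y : E3} (hy : 1 ≤ ‖y‖) : cylCutoff y = 1 :=
  Real.smoothTransition.one_of_one_le (by nlinarith)

/-- `χ` vanishes near the origin. [folklore] -/
theorem cylCutoff_eventuallyEq_zero : cylCutoff =ᶠ[𝓝 (0 : E3)] fun _ ↦ 0 := by
  filter_upwards [Metric.closedBall_mem_nhds (0 : E3) (by norm_num : (0 : ℝ) < 2⁻¹)] with y hy
  rw [Metric.mem_closedBall, dist_zero_right] at hy
  exact cylCutoff_of_norm_le hy

/-- **Cutting off near the origin**: if `G` is `C^n` off the origin and `χ` is `C^n` and vanishes near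
the origin, then `χ • G` is `C^n` everywhere (near `0` it is `0`). [folklore] -/
theorem contDiffAt_cutoff_smul {F : Type*} [NormedAddCommGroup F] [NormedSpace ℝ F] {n : WithTop ℕ∞}
    {χ : E3 → ℝ} {G : E3 → F} (hχ : ContDiff ℝ n χ) (hχ0 : χ =ᶠ[𝓝 (0 : E3)] fun _ ↦ 0)
    (hG : ∀ y ≠ 0, ContDiffAt ℝ n G y) (y : E3) : ContDiffAt ℝ n (fun z ↦ χ z • G z) y := by
  by_cases hy : y = 0
  · subst hy
    refine (contDiffAt_const (c := (0 : F))).congr_of_eventuallyEq ?_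
    filter_upwards [hχ0] with z hz
    rw [hz, zero_smul]
  · exact hχ.contDiffAt.smul (hG y hy)

/-! ### The model fields on the punctured space -/

/-- The punctured space `{y ≠ 0}` as an open subset of `E3` (the domain of the cylinder frame).
[folklore] -/
def cylDomain : Opens E3 := ⟨{y : E3 | y ≠ 0}, isOpen_ne⟩

/-- Points of `cylDomain` are nonzero. [folklore] -/
theorem cylDomain_ne_zero (y : cylDomain) : (y : E3) ≠ 0 := y.2

/-- The Kerr cylinder frame on the punctured space, into the chart `Kerr.region a 0 = {r > 0}`
(`0 < r₀`). [folklore] -/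
def cylFrame {r₀ : ℝ} (hr₀ : 0 < r₀) (a τ₀ : ℝ) (R : E3 →ₗᵢ[ℝ] E3) : cylDomain → Kerr.region a 0 :=
  fun y ↦ ⟨kerrCylMap r₀ a τ₀ R (y : E3), by
    rw [Kerr.mem_region, radius_kerrCylMap hr₀.le a τ₀ R (cylDomain_ne_zero y), max_self]
    exact hr₀⟩

/-- `(cylFrame y : E4) = kerrCylMap r₀ a τ₀ R y`. [folklore] -/
@[simp]
theorem coe_cylFrame {r₀ : ℝ} (hr₀ : 0 < r₀) (a τ₀ : ℝ) (R : E3 →ₗᵢ[ℝ] E3) (y : cylDomain) :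
    (cylFrame hr₀ a τ₀ R y : E4) = kerrCylMap r₀ a τ₀ R (y : E3) := rfl

/-- **The pullback metric field `H₀ = ψ^* g_{m,a}` on `E3`** (junk at `y = 0`):
`H₀(y)(v, w) = g_{ψ y}(dψ v, dψ w)` with `dψ = kerrCylDeriv r₀ a R y`. [cite: LiMei2020, Prop. 4.1] -/
def cylH₀ (m a r₀ τ₀ : ℝ) (R : E3 →ₗᵢ[ℝ] E3) (y : E3) : E3 →L[ℝ] E3 →L[ℝ] ℝ :=
  (ContinuousLinearMap.precomp ℝ (kerrCylDeriv r₀ a R y)).comp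
    ((Kerr.bilin m a (kerrCylMap r₀ a τ₀ R y)).comp (kerrCylDeriv r₀ a R y))

/-- `H₀(y)(v, w) = g_{ψ y}(dψ v, dψ w)`. [cite: LiMei2020, Prop. 4.1] -/
@[simp]
theorem cylH₀_apply (m a r₀ τ₀ : ℝ) (R : E3 →ₗᵢ[ℝ] E3) (y v w : E3) :
    cylH₀ m a r₀ τ₀ R y v w =
      Kerr.bilin m a (kerrCylMap r₀ a τ₀ R y) (kerrCylDeriv r₀ a R y v) (kerrCylDeriv r₀ a R y w) :=
  rfl

open scoped Classical in
/-- **The second-fundamental-form field `K₀ = K_ν(ψ)` on `E3`** (zero at `y = 0`): at `y ≠ 0` the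
second fundamental form of the cylinder frame `cylFrame` with respect to its future unit normal
`kerrCylUnitNormal` (sign convention (h) `K(v, w) = +g(D_v ν, dψ w)`), as a continuous bilinear form.
[cite: LiMei2020, Prop. 4.1] -/
def cylK₀ [Kerr.Facts] (m a : ℝ) {r₀ : ℝ} (hr₀ : 0 < r₀) (τ₀ : ℝ) (R : E3 →ₗᵢ[ℝ] E3) (y : E3) :
    E3 →L[ℝ] E3 →L[ℝ] ℝ :=
  if hy : y ≠ 0 then
    haveI : (Kerr.smoothMetric m a 0).HasLeviCivita := PseudoRiemannianMetric.hasLeviCivita _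
    LinearMap.toContinuousBilinearMap (show E3 →ₗ[ℝ] E3 →ₗ[ℝ] ℝ from
      (Kerr.smoothMetric m a 0).secondFundamentalForm 𝓘(ℝ, E3) (cylFrame hr₀ a τ₀ R)
        (fun z ↦ kerrCylUnitNormal m a (cylFrame hr₀ a τ₀ R z : E4)) ⟨y, hy⟩)
  else 0

/-- `K₀(y)(v, w) = K_ν(ψ)_y(v, w)` at `y ≠ 0` (for any proof of the Levi-Civita hypothesis).
[cite: LiMei2020, Prop. 4.1] -/
theorem cylK₀_apply [Kerr.Facts] (m a : ℝ) {r₀ : ℝ} (hr₀ : 0 < r₀) (τ₀ : ℝ) (R : E3 →ₗᵢ[ℝ] E3)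
    [(Kerr.smoothMetric m a 0).HasLeviCivita] {y : E3} (hy : y ≠ 0) (v w : E3) :
    cylK₀ m a hr₀ τ₀ R y v w =
      (Kerr.smoothMetric m a 0).secondFundamentalForm 𝓘(ℝ, E3) (cylFrame hr₀ a τ₀ R)
        (fun z ↦ kerrCylUnitNormal m a (cylFrame hr₀ a τ₀ R z : E4)) ⟨y, hy⟩ v w := by
  rw [cylK₀, dif_pos hy]
  rfl

/-- `K₀(0) = 0`. [folklore] -/
theorem cylK₀_zero [Kerr.Facts] (m a : ℝ) {r₀ : ℝ} (hr₀ : 0 < r₀) (τ₀ : ℝ) (R : E3 →ₗᵢ[ℝ] E3) :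
    cylK₀ m a hr₀ τ₀ R 0 = 0 := by
  rw [cylK₀, dif_neg (not_not.2 rfl)]

/-! ### Smoothness off the origin -/

/-- The differential field `y ↦ kerrCylDeriv r₀ a R y` is `C^n` off the origin (it is the derivative of
the smooth cylinder map there). [folklore] -/
theorem contDiffAt_kerrCylDeriv (r₀ a τ₀ : ℝ) (R : E3 →ₗᵢ[ℝ] E3) {y : E3} (hy : y ≠ 0)
    {n : WithTop ℕ∞} : ContDiffAt ℝ n (kerrCylDeriv r₀ a R) y := by
  have h : ContDiffAt ℝ n (fderiv ℝ (kerrCylMap r₀ a τ₀ R)) y :=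
    (contDiffAt_kerrCylMap r₀ a τ₀ R hy (n := n + 1)).fderiv_right le_rfl
  refine h.congr_of_eventuallyEq ?_
  filter_upwards [isOpen_ne.mem_nhds hy] with z hz
  exact (fderiv_kerrCylMap r₀ a τ₀ R hz).symm

/-- **`H₀ = ψ^* g` is smooth off the origin.** [folklore] -/
theorem contDiffOn_cylH₀ (m a r₀ τ₀ : ℝ) (R : E3 →ₗᵢ[ℝ] E3) (hr₀ : 0 < r₀) :
    ContDiffOn ℝ ∞ (cylH₀ m a r₀ τ₀ R) {y : E3 | y ≠ 0} := by
  refine contDiffOn_clm_apply.mpr fun v ↦ contDiffOn_clm_apply.mpr fun w ↦ fun y hy ↦ ?_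
  have hx : 0 < Kerr.radius a (kerrCylMap r₀ a τ₀ R y) := by
    rw [radius_kerrCylMap hr₀.le a τ₀ R hy]; exact hr₀
  have hB : ContDiffAt ℝ ∞ (fun z : E3 ↦ Kerr.bilin m a (kerrCylMap r₀ a τ₀ R z)) y :=
    (Kerr.contDiffAt_bilin m a hx).comp y (contDiffAt_kerrCylMap r₀ a τ₀ R hy)
  have hL := contDiffAt_kerrCylDeriv r₀ a τ₀ R hy (n := ∞)
  have h : ContDiffAt ℝ ∞ (fun z : E3 ↦ Kerr.bilin m a (kerrCylMap r₀ a τ₀ R z)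
      (kerrCylDeriv r₀ a R z v) (kerrCylDeriv r₀ a R z w)) y :=
    (hB.clm_apply (hL.clm_apply contDiffAt_const)).clm_apply (hL.clm_apply contDiffAt_const)
  exact h.contDiffWithinAt


section Parameters

variable [Kerr.Facts] {m a r₀ : ℝ}

omit [Kerr.Facts] in
/-- `0 < r₀` for admissible parameters (`0 ≤ r₋ < r₀`). [cite: ONeill1995, Ch. 2, §2.3] -/
theorem pos_of_rMinus_lt (ha : |a| < m) (h₁ : Kerr.rMinus m a < r₀) : 0 < r₀ :=
  (Kerr.IsSubextremal.rMinus_nonneg ha).trans_lt h₁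

/-- **`K₀ = K_ν(ψ)` is smooth off the origin** (O'Neill 1983, Ch. 4, Lemma 4: the shape tensor of a
smooth hypersurface with smooth unit normal is a smooth tensor field —
`contMDiffAt_secondFundamentalForm_apply` for the components, `contDiffOn_clm_apply` to assemble).
[cite: ONeill1983, Ch. 4, Lemma 4] -/
theorem contDiffOn_cylK₀ (ha : |a| < m) (h₁ : Kerr.rMinus m a < r₀) (h₂ : r₀ < Kerr.rPlus m a)
    (τ₀ : ℝ) (R : E3 →ₗᵢ[ℝ] E3) :
    ContDiffOn ℝ ∞ (cylK₀ m a (pos_of_rMinus_lt ha h₁) τ₀ R) {y : E3 | y ≠ 0} := by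
  haveI : (Kerr.smoothMetric m a 0).HasLeviCivita := PseudoRiemannianMetric.hasLeviCivita _
  have hr₀ := pos_of_rMinus_lt ha h₁
  have hf : ∀ y, (cylFrame hr₀ a τ₀ R y : E4) = kerrCylMap r₀ a τ₀ R (y : E3) := fun _ ↦ rfl
  refine contDiffOn_clm_apply.mpr fun v ↦ contDiffOn_clm_apply.mpr fun w ↦ fun y hy ↦ ?_
  refine ContDiffAt.contDiffWithinAt ?_
  -- smoothness of the component as a function on the open domain
  have hV : ∀ u : E3, ContMDiffAt 𝓘(ℝ, E3) 𝓘(ℝ, E3).tangent ∞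
      (fun x : cylDomain ↦ (TotalSpace.mk' E3 x (u : TangentSpace 𝓘(ℝ, E3) x) :
        TangentBundle 𝓘(ℝ, E3) cylDomain)) (⟨y, hy⟩ : cylDomain) := fun u ↦
    (OpensChart.contMDiffAt_section_iff (n := ∞) (⟨y, hy⟩ : cylDomain)
      (fun x : cylDomain ↦ (u : TangentSpace 𝓘(ℝ, E3) x))).mpr contMDiffAt_const
  have h := PseudoRiemannianMetric.contMDiffAt_secondFundamentalForm_apply
    ((Kerr.smoothMetric m a 0).toPseudoRiemannianMetric) (I' := 𝓘(ℝ, E3))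
    (contMDiff_kerrCylOn cylDomain_ne_zero hf ∞)
    (contMDiff_kerrCylUnitNormal_lift ha h₁ h₂ cylDomain_ne_zero hf)
    (V := fun x : cylDomain ↦ (v : TangentSpace 𝓘(ℝ, E3) x))
    (W := fun x : cylDomain ↦ (w : TangentSpace 𝓘(ℝ, E3) x)) (y₀ := ⟨y, hy⟩) (hV v) (hV w)
  refine (OpensChart.contMDiffAt_iff (⟨y, hy⟩ : cylDomain) _
    (fun z ↦ cylK₀ m a hr₀ τ₀ R z v w) (fun u ↦ ?_)).mp h
  exact (cylK₀_apply m a hr₀ τ₀ R u.2 v w).symm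

/-- `H₀` is positive definite off the origin (the cylinder is spacelike). [cite: LiMei2020, §4] -/
theorem cylH₀_pos (ha : |a| < m) (h₁ : Kerr.rMinus m a < r₀) (h₂ : r₀ < Kerr.rPlus m a) (τ₀ : ℝ)
    (R : E3 →ₗᵢ[ℝ] E3) {y : E3} (hy : y ≠ 0) {v : E3} (hv : v ≠ 0) :
    0 < cylH₀ m a r₀ τ₀ R y v v := by
  have hr₀ := pos_of_rMinus_lt ha h₁
  have hf : ∀ y, (cylFrame hr₀ a τ₀ R y : E4) = kerrCylMap r₀ a τ₀ R (y : E3) := fun _ ↦ rfl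
  have h := (isSpacelikeImmersion_kerrCylOn (m := m) ha h₁ h₂ cylDomain_ne_zero hf).2 ⟨y, hy⟩ v hv
  rw [PseudoRiemannianMetric.inducedBilin_apply, mfderiv_kerrCylOn_apply cylDomain_ne_zero hf,
    Kerr.smoothMetric_val] at h
  exact h

/-- `K₀` is symmetric (O'Neill 1983, Ch. 4, Lemma 4.4). [cite: ONeill1983, Ch. 4, Lemma 4.4] -/
theorem cylK₀_symm (ha : |a| < m) (h₁ : Kerr.rMinus m a < r₀) (h₂ : r₀ < Kerr.rPlus m a) (τ₀ : ℝ)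
    (R : E3 →ₗᵢ[ℝ] E3) (y v w : E3) :
    cylK₀ m a (pos_of_rMinus_lt ha h₁) τ₀ R y v w = cylK₀ m a (pos_of_rMinus_lt ha h₁) τ₀ R y w v := by
  haveI : (Kerr.smoothMetric m a 0).HasLeviCivita := PseudoRiemannianMetric.hasLeviCivita _
  have hr₀ := pos_of_rMinus_lt ha h₁
  by_cases hy : y = 0
  · subst hy
    rw [cylK₀_zero]
    rfl
  have hf : ∀ y, (cylFrame hr₀ a τ₀ R y : E4) = kerrCylMap r₀ a τ₀ R (y : E3) := fun _ ↦ rfl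
  rw [cylK₀_apply m a hr₀ τ₀ R hy, cylK₀_apply m a hr₀ τ₀ R hy]
  exact PseudoRiemannianMetric.secondFundamentalForm_comm
    ((Kerr.smoothMetric m a 0).toPseudoRiemannianMetric)
    (contMDiff_kerrCylOn cylDomain_ne_zero hf ∞)
    (isUnitNormal_kerrCylUnitNormalOn ha h₁ h₂ cylDomain_ne_zero hf).isNormalTo
    (contMDiff_kerrCylUnitNormal_lift ha h₁ h₂ cylDomain_ne_zero hf) ⟨y, hy⟩ v w

/-! ### The global fields and the datum -/

omit [Kerr.Facts] in
/-- The metric field of the datum: `h = χ H₀ + (1 − χ) δ`. [cite: LiMei2020, Prop. 4.1] -/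
def cylH (m a r₀ τ₀ : ℝ) (R : E3 →ₗᵢ[ℝ] E3) (y : E3) : E3 →L[ℝ] E3 →L[ℝ] ℝ :=
  cylCutoff y • cylH₀ m a r₀ τ₀ R y + (1 - cylCutoff y) • E3.delta

/-- The second-fundamental-form field of the datum: `k = χ K₀`. [cite: LiMei2020, Prop. 4.1] -/
def cylK (m a : ℝ) {r₀ : ℝ} (hr₀ : 0 < r₀) (τ₀ : ℝ) (R : E3 →ₗᵢ[ℝ] E3) (y : E3) :
    E3 →L[ℝ] E3 →L[ℝ] ℝ :=
  cylCutoff y • cylK₀ m a hr₀ τ₀ R y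

omit [Kerr.Facts] in
/-- `h(y)(v, w) = χ H₀(v, w) + (1 − χ) ⟪v, w⟫`. [folklore] -/
theorem cylH_apply (τ₀ : ℝ) (R : E3 →ₗᵢ[ℝ] E3) (y v w : E3) : cylH m a r₀ τ₀ R y v w =
    cylCutoff y * cylH₀ m a r₀ τ₀ R y v w + (1 - cylCutoff y) * ⟪v, w⟫ := by
  simp only [cylH, add_apply, smul_apply, smul_eq_mul, E3.delta_apply]

/-- `k(y)(v, w) = χ K₀(v, w)`. [folklore] -/
theorem cylK_apply (hr₀ : 0 < r₀) (τ₀ : ℝ) (R : E3 →ₗᵢ[ℝ] E3) (y v w : E3) :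
    cylK m a hr₀ τ₀ R y v w = cylCutoff y * cylK₀ m a hr₀ τ₀ R y v w := by
  simp only [cylK, smul_apply, smul_eq_mul]

omit [Kerr.Facts] in
/-- **Cut-off interpolation with a constant**: `χ • G + (1 − χ) • C` is `C^n` everywhere if `G` is
`C^n` off the origin and `χ` is `C^n` and vanishes near the origin. [folklore] -/
theorem contDiffAt_cutoff_interpolate {F : Type*} [NormedAddCommGroup F] [NormedSpace ℝ F]
    {n : WithTop ℕ∞} {χ : E3 → ℝ} {G : E3 → F} (C : F) (hχ : ContDiff ℝ n χ)
    (hχ0 : χ =ᶠ[𝓝 (0 : E3)] fun _ ↦ 0) (hG : ∀ y ≠ 0, ContDiffAt ℝ n G y) (y : E3) :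
    ContDiffAt ℝ n (fun z ↦ χ z • G z + (1 - χ z) • C) y :=
  (contDiffAt_cutoff_smul hχ hχ0 hG y).add ((contDiffAt_const.sub hχ.contDiffAt).smul contDiffAt_const)

omit [Kerr.Facts] in
/-- `h` is smooth on all of `E3` (`0 < r₀`). [folklore] -/
theorem contDiffAt_cylH (hr₀ : 0 < r₀) (τ₀ : ℝ) (R : E3 →ₗᵢ[ℝ] E3) (y : E3) :
    ContDiffAt ℝ ∞ (cylH m a r₀ τ₀ R) y :=
  contDiffAt_cutoff_interpolate (G := cylH₀ m a r₀ τ₀ R) E3.delta contDiff_cylCutoff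
    cylCutoff_eventuallyEq_zero
    (fun _ hz ↦ (contDiffOn_cylH₀ m a r₀ τ₀ R hr₀).contDiffAt (isOpen_ne.mem_nhds hz)) y

/-- `k` is smooth on all of `E3`. [folklore] -/
theorem contDiffAt_cylK (ha : |a| < m) (h₁ : Kerr.rMinus m a < r₀) (h₂ : r₀ < Kerr.rPlus m a)
    (τ₀ : ℝ) (R : E3 →ₗᵢ[ℝ] E3) (y : E3) :
    ContDiffAt ℝ ∞ (cylK m a (pos_of_rMinus_lt ha h₁) τ₀ R) y :=
  contDiffAt_cutoff_smul contDiff_cylCutoff cylCutoff_eventuallyEq_zero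
    (fun _ hz ↦ (contDiffOn_cylK₀ ha h₁ h₂ τ₀ R).contDiffAt (isOpen_ne.mem_nhds hz)) y

/-- `h` is positive definite: a convex combination of `H₀ > 0` (off the origin) and `δ > 0`, and
`= δ` at the origin. [folklore] -/
theorem cylH_pos (ha : |a| < m) (h₁ : Kerr.rMinus m a < r₀) (h₂ : r₀ < Kerr.rPlus m a) (τ₀ : ℝ)
    (R : E3 →ₗᵢ[ℝ] E3) (y : E3) {v : E3} (hv : v ≠ 0) : 0 < cylH m a r₀ τ₀ R y v v := by
  rw [cylH_apply, real_inner_self_eq_norm_sq]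
  have hv2 : 0 < ‖v‖ ^ 2 := by positivity
  have h0 := cylCutoff_nonneg y
  have h1 := cylCutoff_le_one y
  by_cases hy : y = 0
  · subst hy
    rw [cylCutoff_of_norm_le (by simp)]
    linarith
  · have hH := cylH₀_pos ha h₁ h₂ τ₀ R hy hv
    rcases h1.eq_or_lt with h | h
    · rw [h]; linarith
    · nlinarith

/-- **The global exact Kerr-cylinder datum** `(h, k) = (χ ψ^*g + (1 − χ)δ, χ K_ν(ψ))` on `E3`, for
admissible parameters `|a| < m`, `r₋ < r₀ < r₊`, time shift `τ₀` and axis rotation `R`: a smooth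
initial data set (Riemannian `h`, symmetric `k`, smooth sections — over the model space `E3` bundle
smoothness is plain smoothness, `contMDiffAt_bilinE3_iff`) which on `{1 ≤ ‖y‖}` is the datum
induced by Kerr(`m, a`) on the cylinder `{r = r₀}` in standard form. Li–Mei arXiv:2005.01249,
Prop. 4.1 ("the Kerr initial data induced on the slice `r = r₀` inside the black hole with parameters
`(m, a⃗)`"). [cite: LiMei2020, Prop. 4.1] -/
def kerrCylinderDatum (ha : |a| < m) (h₁ : Kerr.rMinus m a < r₀) (h₂ : r₀ < Kerr.rPlus m a)
    (τ₀ : ℝ) (R : E3 →ₗᵢ[ℝ] E3) : InitialDataSet (𝓡 3) E3 where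
  h :=
    { inner := fun y ↦ cylH m a r₀ τ₀ R y
      symm := fun y v w ↦ by
        show cylH m a r₀ τ₀ R y v w = cylH m a r₀ τ₀ R y w v
        rw [cylH_apply, cylH_apply, cylH₀_apply, cylH₀_apply, Kerr.bilin_symm, real_inner_comm]
      pos := fun y v hv ↦ cylH_pos ha h₁ h₂ τ₀ R y hv
      isVonNBounded := fun y ↦
        PseudoRiemannianMetric.IsSpacelikeImmersion.isVonNBounded_setOf_lt_one_of_pos (V := E3)
          (cylH m a r₀ τ₀ R y) (fun v hv ↦ cylH_pos ha h₁ h₂ τ₀ R y hv)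
      contMDiff := fun y ↦ (contMDiffAt_bilinE3_iff (b := fun y : E3 ↦ y) (s := cylH m a r₀ τ₀ R)).2
        ⟨contMDiffAt_id, (contDiffAt_cylH (pos_of_rMinus_lt ha h₁) τ₀ R y).contMDiffAt⟩ }
  k := fun y ↦ cylK m a (pos_of_rMinus_lt ha h₁) τ₀ R y
  k_symm := fun y v w ↦ by
    show cylK m a (pos_of_rMinus_lt ha h₁) τ₀ R y v w = cylK m a (pos_of_rMinus_lt ha h₁) τ₀ R y w v
    rw [cylK_apply, cylK_apply, cylK₀_symm ha h₁ h₂]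
  contMDiff_k := fun y ↦
    (contMDiffAt_bilinE3_iff (b := fun y : E3 ↦ y) (s := cylK m a (pos_of_rMinus_lt ha h₁) τ₀ R)).2
      ⟨contMDiffAt_id, (contDiffAt_cylK ha h₁ h₂ τ₀ R y).contMDiffAt⟩

/-- The metric of the datum is `cylH`. [folklore] -/
@[simp]
theorem kerrCylinderDatum_h_inner (ha : |a| < m) (h₁ : Kerr.rMinus m a < r₀)
    (h₂ : r₀ < Kerr.rPlus m a) (τ₀ : ℝ) (R : E3 →ₗᵢ[ℝ] E3) (y : E3) :
    (kerrCylinderDatum ha h₁ h₂ τ₀ R).h.inner y = cylH m a r₀ τ₀ R y := rfl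

/-- The tensor `k` of the datum is `cylK`. [folklore] -/
@[simp]
theorem kerrCylinderDatum_k (ha : |a| < m) (h₁ : Kerr.rMinus m a < r₀) (h₂ : r₀ < Kerr.rPlus m a)
    (τ₀ : ℝ) (R : E3 →ₗᵢ[ℝ] E3) (y : E3) :
    (kerrCylinderDatum ha h₁ h₂ τ₀ R).k y = cylK m a (pos_of_rMinus_lt ha h₁) τ₀ R y := rfl

/-- On `{1 ≤ ‖y‖}` the metric of the datum is `H₀ = ψ^* g`. [cite: LiMei2020, Prop. 4.1] -/
theorem kerrCylinderDatum_h_inner_apply_of_le (ha : |a| < m) (h₁ : Kerr.rMinus m a < r₀)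
    (h₂ : r₀ < Kerr.rPlus m a) (τ₀ : ℝ) (R : E3 →ₗᵢ[ℝ] E3) {y : E3} (hy : 1 ≤ ‖y‖) (v w : E3) :
    (kerrCylinderDatum ha h₁ h₂ τ₀ R).h.inner y v w = cylH₀ m a r₀ τ₀ R y v w := by
  have h : cylH m a r₀ τ₀ R y v w = cylH₀ m a r₀ τ₀ R y v w := by
    rw [cylH_apply, cylCutoff_of_le_norm hy]
    ring
  exact h

/-- On `{1 ≤ ‖y‖}` the tensor `k` of the datum is `K₀ = K_ν(ψ)`. [cite: LiMei2020, Prop. 4.1] -/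
theorem kerrCylinderDatum_k_apply_of_le (ha : |a| < m) (h₁ : Kerr.rMinus m a < r₀)
    (h₂ : r₀ < Kerr.rPlus m a) (τ₀ : ℝ) (R : E3 →ₗᵢ[ℝ] E3) {y : E3} (hy : 1 ≤ ‖y‖) (v w : E3) :
    (kerrCylinderDatum ha h₁ h₂ τ₀ R).k y v w = cylK₀ m a (pos_of_rMinus_lt ha h₁) τ₀ R y v w := by
  have h : cylK m a (pos_of_rMinus_lt ha h₁) τ₀ R y v w =
      cylK₀ m a (pos_of_rMinus_lt ha h₁) τ₀ R y v w := by
    rw [cylK_apply, cylCutoff_of_le_norm hy, one_mul]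
  exact h

/-- **The datum is exactly the Kerr(`m, a`) cylinder `{r = r₀}` on `{1 < ‖y‖}`** in the sense of
`LiMei.IsKerrCylinderOn` (chart `Kerr.region a 0`, the pinned frame `kerrCylMap r₀ a τ₀ R` on
`Kerr.slice 0 1` with its future unit normal `kerrCylUnitNormal`; `h = ψ^* g` pointwise and
`k = K_ν(ψ)`, the latter for the frame on the punctured space and on the slice alike,
`secondFundamentalForm_kerrCylOn_eq`). In particular the conclusion predicate of
`LiMei.interiorKerrGluing` is satisfiable for all admissible parameters. Li–Mei arXiv:2005.01249,
Prop. 4.1. [cite: LiMei2020, Prop. 4.1] -/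
theorem isKerrCylinderOn_kerrCylinderDatum (ha : |a| < m) (h₁ : Kerr.rMinus m a < r₀)
    (h₂ : r₀ < Kerr.rPlus m a) (τ₀ : ℝ) (R : E3 →ₗᵢ[ℝ] E3) :
    IsKerrCylinderOn m a r₀ τ₀ R {y : E3 | 1 < ‖y‖} (kerrCylinderDatum ha h₁ h₂ τ₀ R) := by
  have hr₀ := pos_of_rMinus_lt ha h₁
  have hm : 0 ≤ m := ((abs_nonneg a).trans_lt ha).le
  obtain ⟨ψ, hψ⟩ := exists_kerrCylFrame (r₁ := 0) hr₀ hr₀ a τ₀ R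
  have hS0 : ∀ z : Kerr.slice 0 1, (z : E3) ≠ 0 := fun z ↦ ne_zero_of_mem_slice z
  have hf : ∀ y, (cylFrame hr₀ a τ₀ R y : E4) = kerrCylMap r₀ a τ₀ R (y : E3) := fun _ ↦ rfl
  have hle : ∀ {z : E3}, z ∈ {y : E3 | 1 < ‖y‖} → 1 ≤ ‖z‖ := fun hz ↦ le_of_lt hz
  refine ⟨0, hm, ψ, fun y ↦ kerrCylUnitNormal m a (ψ y : E4), hr₀, hψ,
    isSpacelikeImmersion_kerrCyl ha h₁ h₂ τ₀ R hψ,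
    isFutureUnitNormal_kerrCylUnitNormal hm ha h₁ h₂ τ₀ R hψ, fun y hy ↦ ?_, fun y hy ↦ ?_⟩
  · -- `h = ψ^* g`
    have key : ∀ v w : E3, cylH₀ m a r₀ τ₀ R y v w =
        pullbackBilin (I := 𝓘(ℝ, E4)) (I' := 𝓘(ℝ, E3)) ψ (Kerr.smoothMetric m a 0).val y v w := by
      intro v w
      rw [cylH₀_apply, pullbackBilin_apply, mfderiv_kerrCylOn_apply hS0 hψ,
        mfderiv_kerrCylOn_apply hS0 hψ, Kerr.smoothMetric_val, hψ y]
      rfl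
    refine ContinuousLinearMap.ext fun v ↦ ContinuousLinearMap.ext fun w ↦ ?_
    exact (kerrCylinderDatum_h_inner_apply_of_le ha h₁ h₂ τ₀ R (hle hy) v w).trans (key v w)
  · -- `k = K_ν(ψ)`
    have key : ∀ v w : E3, (kerrCylinderDatum ha h₁ h₂ τ₀ R).k y v w =
        (Kerr.smoothMetric m a 0).secondFundamentalForm 𝓘(ℝ, E3) ψ
          (fun z ↦ kerrCylUnitNormal m a (ψ z : E4)) y v w := fun v w ↦
      (kerrCylinderDatum_k_apply_of_le ha h₁ h₂ τ₀ R (hle hy) v w).trans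
        ((cylK₀_apply m a hr₀ τ₀ R (hS0 y) v w).trans
          (secondFundamentalForm_kerrCylOn_eq ha h₁ h₂ cylDomain_ne_zero hf hS0 hψ ⟨y, hS0 y⟩ y
            rfl v w))
    exact LinearMap.ext₂ fun v w ↦ key v w

/-- **The datum solves the vacuum constraint equations on `{1 < ‖y‖}`** (exact Kerr-cylinder data
are vacuum, `isVacuumOn_of_isKerrCylinderOn`). Li–Mei arXiv:2005.01249, Prop. 4.1; Choquet-Bruhat
2009, Ch. VI, Thm. 3.3. [cite: LiMei2020, Prop. 4.1] -/
theorem isVacuumOn_kerrCylinderDatum (ha : |a| < m) (h₁ : Kerr.rMinus m a < r₀)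
    (h₂ : r₀ < Kerr.rPlus m a) (τ₀ : ℝ) (R : E3 →ₗᵢ[ℝ] E3) :
    IsVacuumOn {y : E3 | 1 < ‖y‖} (kerrCylinderDatum ha h₁ h₂ τ₀ R) :=
  isVacuumOn_of_isKerrCylinderOn (isOpen_lt continuous_const continuous_norm) (fun _ h ↦ h)
    ha h₁ h₂ (isKerrCylinderOn_kerrCylinderDatum ha h₁ h₂ τ₀ R)

end Parameters

end LiMei

end Literature.Geometry.Lorentzian

end
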